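import Summits.QuantumFields.Balaban3D.Proofs.Bound55Masses

/-!
# `Summit.QuantumFields.Balaban3D.Proofs.MassesAC` — the MASSES of the large-field histories of [Balaban1985UV3] (41) p. 266 as EXACT
# (uncapped) Radon–Nikodym transports, for an averaging that is merely ABSOLUTELY CONTINUOUS (`Carriers.AvgAC`) — lane `pub-balaban3d`,
# seat alpha-1 (definition request `defn-AlphaInputsT3AC` of route `UnitScaleTilt`)

WHY (seat finding F-α1-1).  Seat p1's `Carriers.Masses.massRec` PINS the a.e.-class print defines into `[0,1]` (`min 1 (max 0 (T_k[w·m_k]))`)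
and the trivial history to `1`; the step leaf then needs `hm₁ : T_k[w(h′)·m_k(proj h′)] ≤ m_{k+1}(h′)` a.e. (`Bound55Tower.bound55_of_select`),
which at `h′ = triv` reads `T_k[1] ≤ 1` a.e. and — since `∫ T_k[1] dV = ∫ 1 dU = 1` — forces `T_k[1] = 1` a.e., i.e. EXACT Haar compatibility
`Ū_*(dU) = dV` of the averaging (`B10Eq2HaarCompatibility.map_avg_eq_iff_T_one_ae_eq_one`).  For the block averaging `blockAvg ℰp` of the T³
family (route `UnitScaleTilt`) only `AvgAC` is in the tree (`T3UnitLawDensityEML.haarAC_blockAvg`) and exact Haar-ness fails for non-abelian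
`G` (cell ym-nodeO-ideate, P2 g25 reading).  REMEDY: drop the cap.  `massRecAC` below is the SAME recursion with the masses the EXACT
transports `T_k[w_k(h′)·m_k(proj h′)]` (the local Jacobians of `Ū` ride INSIDE the transport — honest: print's «∫dV_k↾_{Z_k} δ(V̄_kV^{−1}) ⋯»
is that transport, and print never claims `≤ 1`), and the trivial history FLOORED at `1` (`max 1 (T_k[w(triv)·m_k(triv)])`) so that the R-RN
version selection keeps `lower57 ≤ upper55` POINTWISE (`Bound55Tower.lower57_le_upper55` needs `m(triv) ≥ 1`; enlarging a mass only weakens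
the UPPER bound (41)).  Then `hm₁` holds with NO hypothesis on the averaging (pointwise on trivial/admissible histories, a.e. on the
inadmissible ones where both sides vanish), and everything else the step leaf consumes (`hcover`, measurability, integrability) is proved
here.  The price: masses are no longer `≤ 1`, so they cannot inhabit `Carriers.HistWeights`; the AC tower objects are built in
`…Proofs.TowerAC` directly as the spine's `SectB.TowerObjects` (which carries no mass bound).

WHAT THIS FILE PROVES ([folklore] measure theory; nothing of CMP 102 asserted): `massRecAC` and `massRecAC_nonneg`, `massRecAC_zero`,
`one_le_massRecAC_triv`, `massRecAC_eq_zero_of_not_admissible`, `massRecAC_succ` (= the exact transport, POINTWISE, admissible non-trivial),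
`massRecAC_triv_succ`, `measurable_massRecAC`, `integrable_massRecAC` (RN transports of integrable densities are integrable),
`transport_le_massRecAC_ae` (`hm₁`, no averaging hypothesis), `massRecAC_cover` (`hcover`, from seat p4's `stepWeight_mul_chiB_cover`).
-/

noncomputable section

namespace Summit.QuantumFields.Balaban3D.Proofs.MassesAC

open _root_.MeasureTheory
open Literature.MathematicalPhysics.QuantumFieldTheory.Balaban1983to89
open Literature.MathematicalPhysics.QuantumFieldTheory.Balaban1983to89.AveragingRT (rnTransport rnTransport_nonneg)
open Summit.QuantumFields.Balaban3D.Carriers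
open Summit.QuantumFields.Balaban3D.Proofs.Bound55Masses (chiB measurable_stepWeight stepWeight_mul_chiB_cover rnTransport_zero_ae)

variable {P : Params} {G : Type} [GaugeGroup G] [MeasurableSpace G] [HaarData G]
  (M₁ : ℕ) (Rcol : ℕ → ℕ) (εL εS : ℕ → ℝ) (av : ∀ j, Averaging P j G)

/-! ## §1 The recursion -/

open Classical in
/-- **THE MASSES `m_k(h, V)` of (41) AS EXACT TRANSPORTS** (the integrated-out «Σ_{{Ω_j}} ∫dV_{k−1}↾_{Z_{k−1}} δ(V̄_{k−1}V^{−1}) ⋯ χ_k ζ χ_{k−1} ⋯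
ζ_{Ω₁ᶜ}» of [Balaban1985UV3] (41) p. 266 in the push-forward reading, seat p1's D-p1-5, WITHOUT the `[0,1]` pin): `m_0 = 1`;
`m_{k+1}(triv) = max 1 (T_k[w_k(triv)·m_k(triv)])` (floored at `1` — the (47)-term; for a Haar-compatible `Ū` this is `1` a.e.);
`m_{k+1}(h′) = max 0 (T_k[w_k(h′)·m_k(proj h′)]) = T_k[w_k(h′)·m_k(proj h′)]` for admissible non-trivial `h′` (`max 0` is a no-op, the
integrand is non-negative); `0` for inadmissible `h′`.  `T_k = rnTransport Ū_k`, `w_k` = seat p1's `stepWeight` (large field on `P_k =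
last h′`, small field on `Λ_k(h′)`, thresholds `εL`/`εS`). [cite: Balaban1985UV3, (41) p.266 + (48) p.268] -/
def massRecAC : (k : ℕ) → Hist P k → GaugeField P k G → ℝ
  | 0, _, _ => 1
  | k + 1, h, V =>
      if h = Hist.triv P (k + 1) then
        max 1 (rnTransport (av k).avg (fun U => stepWeight M₁ Rcol εL εS k h U * massRecAC k h.proj U) V)
      else if Hist.Admissible M₁ Rcol (k + 1) h then
        max 0 (rnTransport (av k).avg (fun U => stepWeight M₁ Rcol εL εS k h U * massRecAC k h.proj U) V)
      else 0

/-- `m_0 = 1` ((41)₀ is (1): nothing integrated). [folklore] -/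
theorem massRecAC_zero (h : Hist P 0) (V : GaugeField P 0 G) : massRecAC M₁ Rcol εL εS av 0 h V = 1 := rfl

open Classical in
/-- `m ≥ 0`. [folklore] -/
theorem massRecAC_nonneg : ∀ (k : ℕ) (h : Hist P k) (V : GaugeField P k G), 0 ≤ massRecAC M₁ Rcol εL εS av k h V
  | 0, _, _ => zero_le_one
  | k + 1, h, V => by
    show 0 ≤ ite _ _ _
    split_ifs
    · exact zero_le_one.trans (le_max_left _ _)
    · exact le_max_left _ _
    · exact le_rfl

open Classical in
/-- **The trivial history has mass `≥ 1`, pointwise, at every level** (the floor; gives `lower57 ≤ upper55` for the version selection). [folklore] -/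
theorem one_le_massRecAC_triv : ∀ (k : ℕ) (V : GaugeField P k G), 1 ≤ massRecAC M₁ Rcol εL εS av k (Hist.triv P k) V
  | 0, _ => le_rfl
  | k + 1, V => by
    show 1 ≤ ite _ _ _
    rw [if_pos rfl]
    exact le_max_left _ _

open Classical in
/-- The trivial history's recursion step: `m_{k+1}(triv) = max 1 (T_k[w_k(triv)·m_k(triv)])`. [folklore] -/
theorem massRecAC_triv_succ (k : ℕ) (V : GaugeField P (k + 1) G) :
    massRecAC M₁ Rcol εL εS av (k + 1) (Hist.triv P (k + 1)) V =
      max 1 (rnTransport (av k).avg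
        (fun U => stepWeight M₁ Rcol εL εS k (Hist.triv P (k + 1)) U * massRecAC M₁ Rcol εL εS av k (Hist.triv P k) U) V) := by
  show ite _ _ _ = _
  rw [if_pos rfl, Hist.proj_triv]

open Classical in
/-- **Inadmissible histories have mass `0`, pointwise.** [folklore] -/
theorem massRecAC_eq_zero_of_not_admissible : ∀ (k : ℕ) (h : Hist P k) (V : GaugeField P k G),
    ¬ Hist.Admissible M₁ Rcol k h → massRecAC M₁ Rcol εL εS av k h V = 0
  | 0, _, _, hh => absurd trivial hh
  | k + 1, h, V, hh => by
    show ite _ _ _ = 0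
    rw [if_neg (fun ht => hh (by rw [ht]; exact Hist.admissible_triv M₁ Rcol (k + 1))), if_neg hh]

open Classical in
/-- **The recursion step for an ADMISSIBLE, NON-TRIVIAL history is the EXACT transport, pointwise**: `m_{k+1}(h′) = T_k[w_k(h′)·m_k(proj h′)]`
(print's «∫dV_k↾_{Z_k} δ(V̄_kV^{−1}) ζχ_k ⋯» of (48), no truncation). [cite: Balaban1985UV3, (48) p.268] -/
theorem massRecAC_succ (k : ℕ) (h : Hist P (k + 1)) (hh : Hist.Admissible M₁ Rcol (k + 1) h) (ht : h ≠ Hist.triv P (k + 1))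
    (V : GaugeField P (k + 1) G) :
    massRecAC M₁ Rcol εL εS av (k + 1) h V =
      rnTransport (av k).avg (fun U => stepWeight M₁ Rcol εL εS k h U * massRecAC M₁ Rcol εL εS av k h.proj U) V := by
  show ite _ _ _ = _
  rw [if_neg ht, if_pos hh, max_eq_right]
  exact rnTransport_nonneg _ _
    (fun U => mul_nonneg (stepWeight_nonneg M₁ Rcol εL εS k h U) (massRecAC_nonneg M₁ Rcol εL εS av k _ U)) V

/-! ## §2 Measurability and integrability -/

open Classical in
/-- **The masses are measurable**, every level and history (the transport is measurable with no hypothesis on the averaging,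
`Carriers.measurable_rnTransport`). [folklore] -/
theorem measurable_massRecAC : ∀ (k : ℕ) (h : Hist P k), Measurable (massRecAC M₁ Rcol εL εS av k h)
  | 0, _ => measurable_const
  | k + 1, h => by
    by_cases ht : h = Hist.triv P (k + 1)
    · subst ht
      have : massRecAC M₁ Rcol εL εS av (k + 1) (Hist.triv P (k + 1)) = fun V => max 1 (rnTransport (av k).avg
          (fun U => stepWeight M₁ Rcol εL εS k (Hist.triv P (k + 1)) U *
            massRecAC M₁ Rcol εL εS av k (Hist.triv P k) U) V) :=
        funext fun V => massRecAC_triv_succ M₁ Rcol εL εS av k V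
      rw [this]
      exact measurable_const.max (measurable_rnTransport _ _)
    by_cases hh : Hist.Admissible M₁ Rcol (k + 1) h
    · have : massRecAC M₁ Rcol εL εS av (k + 1) h = fun V => rnTransport (av k).avg
          (fun U => stepWeight M₁ Rcol εL εS k h U * massRecAC M₁ Rcol εL εS av k h.proj U) V :=
        funext fun V => massRecAC_succ M₁ Rcol εL εS av k h hh ht V
      rw [this]
      exact measurable_rnTransport _ _
    · have : massRecAC M₁ Rcol εL εS av (k + 1) h = fun _ => 0 :=
        funext fun V => massRecAC_eq_zero_of_not_admissible M₁ Rcol εL εS av (k + 1) h V hh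
      rw [this]; exact measurable_const

variable [RegularGaugeGroup G]

/-- A step weight times an integrable density is integrable (`w ∈ [0,1]` measurable). [folklore] -/
theorem integrable_stepWeight_mul (k : ℕ) (h : Hist P (k + 1)) {m : Density P k G} (hm : Integrable m (fieldMeasure P k G)) :
    Integrable (fun U => stepWeight M₁ Rcol εL εS k h U * m U) (fieldMeasure P k G) :=
  hm.bdd_mul (measurable_stepWeight M₁ Rcol εL εS k h).aestronglyMeasurable (c := 1)
    (Filter.Eventually.of_forall fun U => by
      rw [Real.norm_eq_abs, abs_of_nonneg (stepWeight_nonneg M₁ Rcol εL εS k h U)]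
      exact stepWeight_le_one M₁ Rcol εL εS k h U)

open Classical in
/-- **The masses are integrable**, every level and history: RN transports of integrable densities are integrable (`Carriers.integrable_rnTransport`,
RN derivative of a FINITE measure), `max 0`/`max 1` preserve integrability on the (probability) field space. [folklore] -/
theorem integrable_massRecAC : ∀ (k : ℕ) (h : Hist P k), Integrable (massRecAC M₁ Rcol εL εS av k h) (fieldMeasure P k G)
  | 0, _ => integrable_const _
  | k + 1, h => by
    have hT : Integrable (rnTransport (av k).avg
        (fun U => stepWeight M₁ Rcol εL εS k h U * massRecAC M₁ Rcol εL εS av k h.proj U)) (fieldMeasure P (k + 1) G) :=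
      integrable_rnTransport _ _ (integrable_stepWeight_mul M₁ Rcol εL εS k h (integrable_massRecAC k h.proj))
    by_cases ht : h = Hist.triv P (k + 1)
    · subst ht
      have : massRecAC M₁ Rcol εL εS av (k + 1) (Hist.triv P (k + 1)) = (fun _ => (1 : ℝ)) ⊔ rnTransport (av k).avg
          (fun U => stepWeight M₁ Rcol εL εS k (Hist.triv P (k + 1)) U *
            massRecAC M₁ Rcol εL εS av k (Hist.triv P (k + 1)).proj U) :=
        funext fun V => by rw [massRecAC_triv_succ, Hist.proj_triv]; rfl
      rw [this]
      exact (integrable_const _).sup hT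
    by_cases hh : Hist.Admissible M₁ Rcol (k + 1) h
    · have : massRecAC M₁ Rcol εL εS av (k + 1) h = rnTransport (av k).avg
          (fun U => stepWeight M₁ Rcol εL εS k h U * massRecAC M₁ Rcol εL εS av k h.proj U) :=
        funext fun V => massRecAC_succ M₁ Rcol εL εS av k h hh ht V
      rw [this]; exact hT
    · have : massRecAC M₁ Rcol εL εS av (k + 1) h = fun _ => 0 :=
        funext fun V => massRecAC_eq_zero_of_not_admissible M₁ Rcol εL εS av (k + 1) h V hh
      rw [this]; exact integrable_const _

/-! ## §3 The two hypotheses of the step leaf: `hm₁` (no averaging hypothesis) and `hcover` -/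

omit [RegularGaugeGroup G] in
open Classical in
/-- **`hm₁` FOR THE EXACT MASSES, WITH NO HYPOTHESIS ON THE AVERAGING** (the form consumed by `TransportAC.transport41_le_sum_ae_of_ac`):
for EVERY new history `h′`, `T_k[w_k(h′)·m_k(proj h′)] ≤ m_{k+1}(h′)` dV-a.e. — trivial history: `≤ max 1 (·)` pointwise; admissible
non-trivial: EQUALITY pointwise (`massRecAC_succ`); inadmissible: the weight vanishes identically and `T_k 0 = 0` a.e.
(`Bound55Masses.rnTransport_zero_ae`).  Contrast `Bound55Masses.histWeights3_transport_le_mass_ae`, which needs `Ū_*(dU) = dV`. [cite: Balaban1985UV3, (48) p.268] -/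
theorem transport_le_massRecAC_ae (k : ℕ) (h' : Hist P (k + 1)) :
    (rnTransport (av k).avg
        fun U => stepWeight M₁ Rcol εL εS k h' U * massRecAC M₁ Rcol εL εS av k h'.proj U)
      ≤ᵐ[fieldMeasure P (k + 1) G] massRecAC M₁ Rcol εL εS av (k + 1) h' := by
  by_cases ht : h' = Hist.triv P (k + 1)
  · subst ht
    refine Filter.Eventually.of_forall fun V => ?_
    rw [massRecAC_triv_succ, Hist.proj_triv]
    exact le_max_right _ _
  by_cases hh : Hist.Admissible M₁ Rcol (k + 1) h'
  · refine Filter.Eventually.of_forall fun V => ?_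
    rw [massRecAC_succ M₁ Rcol εL εS av k h' hh ht V]
  · have hL : ∀ V, massRecAC M₁ Rcol εL εS av (k + 1) h' V = 0 := fun V =>
      massRecAC_eq_zero_of_not_admissible M₁ Rcol εL εS av (k + 1) h' V hh
    have hint : (fun U => stepWeight M₁ Rcol εL εS k h' U * massRecAC M₁ Rcol εL εS av k h'.proj U)
        = fun _ => (0 : ℝ) := funext fun U => by rw [stepWeight_of_not_admissible M₁ Rcol εL εS k hh U, zero_mul]
    rw [hint]
    filter_upwards [rnTransport_zero_ae k (av k).avg] with V hV
    rw [hL V, hV]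

omit [RegularGaugeGroup G] in
/-- **`hcover` FOR THE EXACT MASSES** (the decomposition of unity (7)–(8) at scale `k`, seat p4's `stepWeight_mul_chiB_cover`): wherever
`m_k(h, U) ≠ 0` (so `h` is admissible) the new history `h ⌢ P_k(U)` above `h` has full weight `stepWeight·chiB ≥ 1` (`chiB` at the
decomposition threshold `εL k`; needs `εL k ≤ εS k` at this step). [cite: Balaban1985UV3, (7)–(8) pp.257–258] -/
theorem massRecAC_cover (k : ℕ) (hLS : εL k ≤ εS k) (h : Hist P k) (U : GaugeField P k G)
    (hm : massRecAC M₁ Rcol εL εS av k h U ≠ 0) :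
    ∃ h' : Hist P (k + 1), h'.proj = h ∧
      (1 : ℝ) ≤ stepWeight M₁ Rcol εL εS k h' U * chiB M₁ Rcol εL k h' U := by
  have hh : Hist.Admissible M₁ Rcol k h := by
    by_contra hna
    exact hm (massRecAC_eq_zero_of_not_admissible M₁ Rcol εL εS av k h U hna)
  exact ⟨_, stepWeight_mul_chiB_cover M₁ Rcol εL εS k hLS h hh U⟩

/-! ## §4 The a.e. recursion without the floor (honesty: the floor at the trivial history modifies nothing the transport sees from below) -/

omit [RegularGaugeGroup G] in
/-- For an admissible non-trivial history the mass IS the transported weighted mass (pointwise restatement of `massRecAC_succ` as an a.e.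
equality, the form `B10`-side consumers quote). [cite: Balaban1985UV3, (48) p.268] -/
theorem massRecAC_succ_ae (k : ℕ) (h' : Hist P (k + 1)) (hh : Hist.Admissible M₁ Rcol (k + 1) h') (ht : h' ≠ Hist.triv P (k + 1)) :
    massRecAC M₁ Rcol εL εS av (k + 1) h' =ᵐ[fieldMeasure P (k + 1) G]
      rnTransport (av k).avg (fun U => stepWeight M₁ Rcol εL εS k h' U * massRecAC M₁ Rcol εL εS av k h'.proj U) :=
  Filter.Eventually.of_forall fun V => massRecAC_succ M₁ Rcol εL εS av k h' hh ht V

end Summit.QuantumFields.Balaban3D.Proofs.MassesAC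

end
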